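import Literature.NumberTheory.LFunctions.Zhang2022.Section3Lemma35Holds
import Literature.NumberTheory.LFunctions.Zhang2022.RepairGapLemma31ScaleLaw
import HarnessLib

/-!
# Zhang (2022), rescue GAP/REQSIDE (D-0124 (4)–(5)): the SCALE LAW of Lemma 3.5 — under
# `‖L(1,χ)‖ ≤ 𝓛^{−(k+11)}` the inequality `|X₃(P²,ψ)| + ∫|X₃| dx/x < 𝓛^{−τ}` fails for at most
# `O(𝔓𝓛^{95+2τ−k})` characters `ψ ∈ Ψ` (printed `k = 2011`, `τ = 585`: `𝔓𝓛^{−746} ≤ 𝔓𝓛^{−739}`)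

Topic `Literature/NumberTheory/LFunctions/Zhang2022` (Landau–Siegel audit tree; verdict-neutral).
Y. Zhang, *Discrete mean estimates and the Landau–Siegel zero*, arXiv:2211.02515v1 (2022)
[Zhang2022LandauSiegel] — **an unrefereed manuscript under adjudication; nothing in this file asserts or
denies its Theorems 1–2, and nothing here is a claim about Landau–Siegel zeros. The programme SEARCHES and
TYPES; no claim about Landau–Siegel zeros, Theorems 1–2 of arXiv:2211.02515 or a repaired Margin232 until a
kernel theorem says so.**

Lemma 3.5 (§3 p. 7 / p. 15: "Assume that (A) holds. The inequality (3.5)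
`|X₃(P²,ψ)| + ∫_{D⁴}^{P²}|X₃(x,ψ)| dx/x < 𝓛^{−585}` holds for all but at most `O(𝔓𝓛^{−739})` characters
`ψ ∈ Ψ`"; proof: "By Cauchy's inequality, the second assertion of Lemma 3.3 and Lemma 3.1,
`∑_ψ (…)² ≪ P²𝓛^{−1993} ≪ 𝔓𝓛^{−1909}`") is the tree theorem `Skeleton.lemma35_holds` (file
`Section3Lemma35Holds`: large sieve + Cauchy–Schwarz in `dx/x` give the second moment
`≤ 9𝓛^{18}·20P²·C₁𝓛^{−2011} ≤ 360C₁𝔓𝓛^{−1916}`, Chebyshev at `𝓛^{−585}` leaves `≤ 360C₁𝔓𝓛^{−746}` exceptions).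
The rescue's exponent budget (kit LP-3 j271838; kernel twin `Repair.Gap.ExpTuple`, `RepairGapExponentBudget`)
carries this step as the DESK READING «Lemma 3.5 exceptional-count exponent `e₃ = (s₁ − 102) − 2τ₃`»
(`ExpTuple.e3`; `s₁` = the Lemma 3.1 saving, `τ₃` = the threshold exponent of (3.5)) — on the S0 binding chain
`e₃ ≥ e_req` that gives `E_min(S0) = 2000`. This file DERIVES the reading from the tree's proof with the three
exponents left free (and the tree's sharper constant `95 = 18 + 77` in place of the desk's `102`):

* `lemma35_scale_of_norm_le` — for natural `k`, `τ` there are `C = C(k)` and `D₀` with: for `D ≥ D₀`, `χ` primitive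
  with `χ² = 1` and `‖L(1,χ)‖ ≤ 𝓛^{−(k+11)}`, the number of `ψ ∈ Ψ` with
  `|X₃(P²,ψ)| + ∫_{D⁴}^{P²}|X₃(x,ψ)| dx/x ≥ 𝓛^{−τ}` is `≤ C·𝔓·𝓛^{95+2τ}/𝓛^{k}` — Lemma 3.1 enters through
  its scale law at the printed range `x_P = 9` (`Repair.Gap.lemma31_scale_of_norm_le 9 k`: saving `𝓛^{−k}` from
  exponent `k + 2 + 9`), the moment is `≤ 180C₁P²𝓛^{18−k} ≤ 360C₁𝔓𝓛^{95−k}`, Chebyshev at `𝓛^{−τ}` costs `𝓛^{2τ}`;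
* `lemma35_scale_of_assumptionAWith` — the `ForAllLarge` form from `Repair.Bed.AssumptionAWith E`, every real
  `E ≥ k + 11`;
* `not_ineq35_count_of_assumptionAWith` — at the printed threshold `τ = 585` (the skeleton's `Ineq35`):
  `#{ψ ∈ Ψ : ¬(3.5)} ≤ C·𝔓·𝓛^{1265}/𝓛^{k}` under `AssumptionAWith E`, `E ≥ k + 11` (the typed node
  `Skeleton.Lemma35` = `C𝔓𝓛^{−739}` is `k ≥ 2004`, i.e. `E ≥ 2015`; the printed `E = 2022` gives `k = 2011`,
  `𝓛^{−746}`, as in `lemma35_holds` — not restated).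

READING (GAP G-31 / REQSIDE (5), as-typed): composed with the Lemma 3.1 scale law, Lemma 3.5 at threshold `𝓛^{−τ}`
leaves `O(𝔓𝓛^{−e})` exceptions with `e = E − 106 − 2τ` from (A) at exponent `E` (`= (s₁ − 95) − 2τ`,
`s₁ = E − 11`; desk: `(s₁ − 102) − 2τ₃`, slack `7` = the manuscript's `P² ≪ 𝔓𝓛^{84}` against (2.9)'s `𝔓𝓛^{77}`).
Sufficiency only; where `e ≥ e_req` is consumed (Prop. 2.1, (7.5)) is not this file's subject. Theorems only; no
definition, no named fact; nothing about (A) itself is asserted.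

## References

* Y. Zhang, arXiv:2211.02515v1 (2022), §3 Lemmas 3.1, 3.3 (ii), 3.5 (pp. 7, 15); §2 (2.6), (2.9); Assumption (A)
  p. 4. [cite: Zhang2022LandauSiegel, §3, Lemma 3.5]
-/

noncomputable section

open Complex Real Finset MeasureTheory

namespace Literature.NumberTheory.LFunctions.Zhang2022.Repair.Gap

open Literature.NumberTheory.LFunctions.Zhang2022.Skeleton
open Literature.NumberTheory.LFunctions.Zhang2022.Lemma36 (twist36 sum_card_filter_le_of_moment36)
open Literature.NumberTheory.LFunctions.Zhang2022.Repair.Bed (AssumptionAWith)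

/-! ## The scale law: `≤ C·𝔓·𝓛^{95+2τ−k}` exceptions at threshold `𝓛^{−τ}` from `‖L(1,χ)‖ ≤ 𝓛^{−(k+11)}` -/

/-- **Lemma 3.5 with the exponents free (sufficiency).** For natural `k`, `τ` there are `C = C(k)` and `D₀`
such that for every `D ≥ D₀`, every PRIMITIVE Dirichlet character `χ` mod `D` with `χ² = 1` and
`‖L(1,χ)‖ ≤ (log D)^{−(k+11)}`, the number of `ψ ∈ Ψ` (primitive characters to prime moduli `p ∼ P`) with
`|X₃(P²,ψ)| + ∫_{D⁴}^{P²} |X₃(x,ψ)| dx/x ≥ 𝓛^{−τ}` is at most `C·𝔓·𝓛^{95+2τ}/𝓛^{k}`. The tree's proof of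
`Skeleton.lemma35_holds` verbatim with Lemma 3.1 ↦ `lemma31_scale_of_norm_le 9 k` and the Chebyshev threshold
free: moment `≤ 9𝓛^{18}·20P²·C₁𝓛^{−k}`, `P² ≤ 2𝔓𝓛^{77}` ((2.9), `bigP_sq_le_frakP`), count `≤ 360C₁𝔓𝓛^{95+2τ−k}`.
[cite: Zhang2022LandauSiegel, §3, Lemma 3.5] -/
theorem lemma35_scale_of_norm_le (k τ : ℕ) :
    ∃ C : ℝ, ∃ D₀ : ℕ, ∀ (D : ℕ) [NeZero D] (χ : DirichletCharacter ℂ D),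
    D₀ ≤ D → χ.IsPrimitive → χ ^ 2 = 1 →
    ‖χ.LFunction 1‖ ≤ 1 / Real.log D ^ (k + 11) →
      (({x : Chr D | (ell D ^ τ)⁻¹ ≤
          ‖X3 χ x (bigP D ^ 2)‖ + ∫ y in (D : ℝ) ^ 4..bigP D ^ 2, ‖X3 χ x y‖ / y}.ncard : ℕ) : ℝ) ≤
        C * frakP D * ell D ^ (95 + 2 * τ) / ell D ^ k := by
  classical
  obtain ⟨C₁, hC₁⟩ := lemma31_scale_of_norm_le 9 k (by norm_num)
  obtain ⟨D₁, hD₁⟩ := bigP_sq_le_frakP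
  refine ⟨360 * max C₁ 0, max ⌈Real.exp 3⌉₊ D₁, fun D _ χ hD hp hχ2 hA => ?_⟩
  have hlog : 3 ≤ Real.log D := by
    have h : Real.exp 3 ≤ D := le_trans (Nat.le_ceil _) (by exact_mod_cast le_trans (le_max_left _ _) hD)
    exact (Real.le_log_iff_exp_le (lt_of_lt_of_le (Real.exp_pos _) h)).mpr h
  have hA' : ‖χ.LFunction 1‖ ≤ 1 / Real.log D ^ (k + 2 + 9) := by
    rw [show k + 2 + 9 = k + 11 by ring]; exact hA
  have hs0 : (s0 D).re = 1 / 2 := by simp [s0, SmoothWeight.s0]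
  set L : ℝ := Real.log D with hLdef
  have hL1 : 1 ≤ L := by linarith
  have hL0 : 0 < L := by linarith
  have hLne : L ≠ 0 := hL0.ne'
  set Cm : ℝ := max C₁ 0 with hCm
  have hCm0 : 0 ≤ Cm := le_max_right _ _
  -- the objects
  set A : ℕ := D ^ 4 with hAdef
  set b : ℝ := bigP D ^ 2 with hbdef
  set Q : ℕ := ⌈bigP D * (1 + (ell D ^ 68)⁻¹)⌉₊ with hQdef
  have hApos : 0 < A := pow_pos (Nat.pos_of_ne_zero (NeZero.ne D)) 4
  have hAb : (A : ℝ) ≤ b := pow_four_le_bigP_sq hlog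
  have hP1 : 1 ≤ bigP D := by rw [bigP]; exact Real.one_le_exp (by rw [ell]; positivity)
  have hb1 : 1 ≤ b := one_le_pow₀ hP1
  -- Lemma 3.1 (scale law at `x = 9`) at `N = ⌊P²⌋`: the weight `W ≤ C₁𝓛^{−k}`
  set W : ℝ := ∑ n ∈ Ioc A ⌊b⌋₊, ‖nu χ n‖ ^ 2 * (n : ℝ) ^ (-(2 * (s0 D).re)) with hWdef
  have hW : W ≤ Cm / L ^ k := by
    have hN : (⌊b⌋₊ : ℝ) ≤ Real.exp (2 * Real.log D ^ 9) := by
      rw [← bigP_sq_eq]; exact Nat.floor_le (by positivity)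
    have h31 := hC₁ D χ hp hχ2 hlog hA' ⌊b⌋₊ hN
    have hWeq : W = ∑ n ∈ Ioc A ⌊b⌋₊, ‖divisorSumChar χ n‖ ^ 2 / n := by
      refine sum_congr rfl fun n _ => ?_
      rw [hs0, show -(2 * (1 / 2 : ℝ)) = -1 by norm_num, Real.rpow_neg_one, div_eq_mul_inv]
      rfl
    rw [hWeq]
    exact h31.trans (div_le_div_of_nonneg_right (le_max_left _ _) (by positivity))
  -- the generic moment bound (large sieve + Cauchy–Schwarz in `dx/x`)
  have hmom := moment35_le (nu χ) (s0 D) hApos hAb Q (primeWindow D) (primeWindow_subset_Icc D)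
  -- the constants: `2 + 2log²(b/A) ≤ 9𝓛¹⁸`, `⌊b⌋ + 1 + 2Q² ≤ 20P²`
  have hlogc : 2 + 2 * Real.log (b / A) ^ 2 ≤ 9 * L ^ 18 := by
    have ha : (0 : ℝ) < A := Nat.cast_pos.mpr hApos
    have hA1 : (1 : ℝ) ≤ A := by exact_mod_cast hApos
    have hlo : 0 ≤ Real.log (b / A) := Real.log_nonneg ((one_le_div ha).mpr hAb)
    have hhi : Real.log (b / A) ≤ 2 * L ^ 9 := by
      have h1 : b / A ≤ b := div_le_self (by positivity) hA1
      calc Real.log (b / A) ≤ Real.log b := Real.log_le_log (by positivity) h1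
        _ = 2 * L ^ 9 := by rw [hbdef, bigP_sq_eq, Real.log_exp]
    have hsq : Real.log (b / A) ^ 2 ≤ (2 * L ^ 9) ^ 2 := pow_le_pow_left₀ hlo hhi 2
    have h18 : (2 : ℝ) ≤ L ^ 18 := le_trans (by norm_num) (pow_le_pow_left₀ (by norm_num) hlog 18)
    nlinarith [hsq, h18]
  have hKc : (⌊b⌋₊ : ℝ) + 1 + 2 * (Q : ℝ) ^ 2 ≤ 20 * bigP D ^ 2 := by
    have hfl : (⌊b⌋₊ : ℝ) ≤ b := Nat.floor_le (by positivity)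
    have hQ : (Q : ℝ) ≤ 3 * bigP D := ceil_window_le (by rw [← hLdef]; exact hL1)
    have hQ0 : (0 : ℝ) ≤ Q := Nat.cast_nonneg Q
    nlinarith [hfl, hQ, hQ0, hb1, hP1]
  have hW0 : 0 ≤ W := sum_nonneg fun n _ =>
    mul_nonneg (sq_nonneg _) (Real.rpow_nonneg (Nat.cast_nonneg n) _)
  -- the moment: `≤ 9𝓛¹⁸ · 20P² · C₁𝓛^{−k}`
  have hT : ∑ p ∈ primeWindow D, ∑ ψ : DirichletCharacter ℂ p with ψ.IsPrimitive,
      (‖twist36 (nu χ) A (s0 D) ψ ⌊b⌋₊‖ +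
        ∫ x in (A : ℝ)..b, ‖twist36 (nu χ) A (s0 D) ψ ⌊x⌋₊‖ / x) ^ 2 ≤
      9 * L ^ 18 * (20 * bigP D ^ 2) * (Cm / L ^ k) := by
    refine hmom.trans ?_
    have h2 : 0 ≤ 2 + 2 * Real.log (b / A) ^ 2 := by positivity
    exact mul_le_mul (mul_le_mul hlogc hKc (by positivity) (by positivity)) hW hW0 (by positivity)
  -- Chebyshev at `V = 𝓛^{−τ}`
  have hV : 0 < (ell D ^ τ)⁻¹ := by rw [ell]; positivity
  have hcount := sum_card_filter_le_of_moment36 (primeWindow D)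
    (fun p ψ => ‖twist36 (nu χ) A (s0 D) ψ ⌊b⌋₊‖ +
      ∫ x in (A : ℝ)..b, ‖twist36 (nu χ) A (s0 D) ψ ⌊x⌋₊‖ / x) hV hT
  -- the exceptional set embeds in the counted family
  set T : Finset ((p : ℕ) × DirichletCharacter ℂ p) := (primeWindow D).sigma fun p =>
    Finset.univ.filter fun ψ : DirichletCharacter ℂ p =>
      ψ.IsPrimitive ∧ (ell D ^ τ)⁻¹ ≤ ‖twist36 (nu χ) A (s0 D) ψ ⌊b⌋₊‖ +
        ∫ x in (A : ℝ)..b, ‖twist36 (nu χ) A (s0 D) ψ ⌊x⌋₊‖ / x with hTdef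
  have hcard : {x : Chr D | (ell D ^ τ)⁻¹ ≤
      ‖X3 χ x (bigP D ^ 2)‖ + ∫ y in (D : ℝ) ^ 4..bigP D ^ 2, ‖X3 χ x y‖ / y}.ncard ≤ T.card := by
    rw [← Set.ncard_coe_finset]
    refine Set.ncard_le_ncard_of_injOn
      (fun x : Chr D => (⟨x.p, x.ψ⟩ : (p : ℕ) × DirichletCharacter ℂ p)) ?_ ?_
      (Finset.finite_toSet T)
    · intro x hx
      rw [Set.mem_setOf_eq, lhs35_eq] at hx
      have hx' : (ell D ^ τ)⁻¹ ≤ ‖twist36 (nu χ) A (s0 D) x.ψ ⌊b⌋₊‖ +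
          ∫ y in (A : ℝ)..b, ‖twist36 (nu χ) A (s0 D) x.ψ ⌊y⌋₊‖ / y := by
        rw [hAdef, hbdef]; exact hx
      rw [Finset.mem_coe, hTdef, Finset.mem_sigma, Finset.mem_filter]
      exact ⟨x.mem, Finset.mem_univ _, x.prim, hx'⟩
    · rintro ⟨p, hp', ψ, hψ⟩ _ ⟨p', hp'', ψ', hψ'⟩ _ h
      simp only [Sigma.mk.injEq] at h
      obtain ⟨rfl, h2⟩ := h
      simp only [heq_eq_eq] at h2
      subst h2
      rfl
  have hTcard : (T.card : ℝ) = ∑ p ∈ primeWindow D, ((Finset.univ.filter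
      fun ψ : DirichletCharacter ℂ p =>
        ψ.IsPrimitive ∧ (ell D ^ τ)⁻¹ ≤ ‖twist36 (nu χ) A (s0 D) ψ ⌊b⌋₊‖ +
          ∫ x in (A : ℝ)..b, ‖twist36 (nu χ) A (s0 D) ψ ⌊x⌋₊‖ / x).card : ℝ) := by
    rw [hTdef, Finset.card_sigma]; push_cast; rfl
  -- `P² ≤ 2𝔓𝓛⁷⁷` and the exponent bookkeeping `18 + 77 + 2τ − k`
  have hP𝔓 : bigP D ^ 2 ≤ 2 * frakP D * L ^ 77 := hD₁ D (le_trans (le_max_right _ _) hD) hlog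
  have h𝔓0 : 0 ≤ frakP D := by
    rw [frakP_eq_sum_primeWindow]; exact sum_nonneg fun p _ => Nat.cast_nonneg p
  calc (({x : Chr D | (ell D ^ τ)⁻¹ ≤ ‖X3 χ x (bigP D ^ 2)‖ +
        ∫ y in (D : ℝ) ^ 4..bigP D ^ 2, ‖X3 χ x y‖ / y}.ncard : ℕ) : ℝ) ≤ T.card := by
        exact_mod_cast hcard
    _ = _ := hTcard
    _ ≤ 9 * L ^ 18 * (20 * bigP D ^ 2) * (Cm / L ^ k) / ((ell D ^ τ)⁻¹) ^ 2 := hcount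
    _ = 180 * Cm * bigP D ^ 2 * (L ^ 18 * L ^ (2 * τ) / L ^ k) := by
        have hV2 : ((ell D ^ τ)⁻¹) ^ 2 = (L ^ (2 * τ))⁻¹ := by rw [ell, ← hLdef, inv_pow, pow_mul']
        rw [hV2]; field_simp; ring
    _ ≤ 180 * Cm * (2 * frakP D * L ^ 77) * (L ^ 18 * L ^ (2 * τ) / L ^ k) := by
        gcongr
    _ = 360 * Cm * frakP D * (L ^ 77 * L ^ 18 * L ^ (2 * τ)) / L ^ k := by ring
    _ = 360 * Cm * frakP D * L ^ (95 + 2 * τ) / L ^ k := by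
        rw [← pow_add, ← pow_add, show 77 + 18 + 2 * τ = 95 + 2 * τ by ring]
    _ = 360 * max C₁ 0 * frakP D * ell D ^ (95 + 2 * τ) / ell D ^ k := by rw [hCm, ell, hLdef]

/-! ## From `AssumptionAWith E`, every real `E ≥ k + 11`, in the `ForAllLarge` shape -/

/-- **Lemma 3.5 with the exponents free, from `AssumptionAWith E`** (`E ≥ k + 11` real), in the skeleton's
`ForAllLarge` shape: for all large `D` and every real primitive `χ` mod `D`, `AssumptionAWith E D χ →
#{ψ ∈ Ψ : |X₃(P²,ψ)| + ∫_{D⁴}^{P²}|X₃| dx/x ≥ 𝓛^{−τ}} ≤ C·𝔓·𝓛^{95+2τ}/𝓛^{k}`.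
[cite: Zhang2022LandauSiegel, §3, Lemma 3.5] -/
theorem lemma35_scale_of_assumptionAWith (k τ : ℕ) {E : ℝ} (hE : ((k + 11 : ℕ) : ℝ) ≤ E) :
    ∃ C : ℝ, ForAllLarge fun D _ χ => AssumptionAWith E D χ →
      (({x : Chr D | (ell D ^ τ)⁻¹ ≤
          ‖X3 χ x (bigP D ^ 2)‖ + ∫ y in (D : ℝ) ^ 4..bigP D ^ 2, ‖X3 χ x y‖ / y}.ncard : ℕ) : ℝ) ≤
        C * frakP D * ell D ^ (95 + 2 * τ) / ell D ^ k := by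
  obtain ⟨C, D₀, hC⟩ := lemma35_scale_of_norm_le k τ
  refine ⟨C, max ⌈Real.exp 3⌉₊ D₀, fun D _ χ hD hq hp hA => ?_⟩
  have hlog : 3 ≤ Real.log D := by
    have h : Real.exp 3 ≤ D := le_trans (Nat.le_ceil _) (by exact_mod_cast le_trans (le_max_left _ _) hD)
    exact (Real.le_log_iff_exp_le (lt_of_lt_of_le (Real.exp_pos _) h)).mpr h
  exact hC D χ (le_trans (le_max_right _ _) hD) hp hq.sq_eq_one
    (norm_le_pow_of_assumptionAWith χ (by linarith) hE hA)

/-- **At the printed threshold `τ = 585`** (the skeleton's (3.5), `Skeleton.Ineq35`): under `AssumptionAWith E`,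
`E ≥ k + 11`, the inequality (3.5) fails for at most `C·𝔓·𝓛^{1265}/𝓛^{k}` characters `ψ ∈ Ψ`, `D` large
(`1265 = 95 + 2·585`; the typed node `Skeleton.Lemma35` with `𝔓𝓛^{−739}` is the case `k ≥ 2004`, and the
printed `E = 2022` gives `k = 2011`: `𝓛^{−746}`, cf. `Skeleton.lemma35_holds`).
[cite: Zhang2022LandauSiegel, §3, Lemma 3.5] -/
theorem not_ineq35_count_of_assumptionAWith (k : ℕ) {E : ℝ} (hE : ((k + 11 : ℕ) : ℝ) ≤ E) :
    ∃ C : ℝ, ForAllLarge fun D _ χ => AssumptionAWith E D χ →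
      (({x : Chr D | ¬ Ineq35 χ x}.ncard : ℕ) : ℝ) ≤ C * frakP D * ell D ^ 1265 / ell D ^ k := by
  obtain ⟨C, D₀, hC⟩ := lemma35_scale_of_assumptionAWith k 585 hE
  refine ⟨C, D₀, fun D _ χ hD hq hp hA => ?_⟩
  have h := hC D χ hD hq hp hA
  have hset : {x : Chr D | ¬ Ineq35 χ x} = {x : Chr D | (ell D ^ 585)⁻¹ ≤
      ‖X3 χ x (bigP D ^ 2)‖ + ∫ y in (D : ℝ) ^ 4..bigP D ^ 2, ‖X3 χ x y‖ / y} := by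
    ext x; simp only [Set.mem_setOf_eq, Ineq35, not_lt]
  rw [hset]
  simpa using h

end Literature.NumberTheory.LFunctions.Zhang2022.Repair.Gap

end
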